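import Mathlib

/-!
# SpinLagrangian — the Kuga–Satake eightfold of a quaternionic rank-6 K3-type lattice is of SPLIT Weil type for every polarization

(solo-blind s51, `work/s51/b2-type-iii.md` §7, PROPOSITION LW (ii); companion of `QuaternionicSplit`.)

Setting.  Let `T` be a rational quadratic space of rank `6` and signature `(2,4)`.  It is isotropic
(Hasse–Minkowski), so `T ≅ U ⊥ T₄` with `U = ⟨f₁, f₂⟩`, `f₁² = 1`, `f₂² = -1`, and `T₄ = ⟨e₁, …, e₄⟩`
diagonal, `eᵢ² = qᵢ`.  In the even Clifford algebra put `E := 1 + f₁f₂` (`= 2ε`, `ε` the idempotent of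
LEMMA Q16), `Y := C⁺(T)·E` (a model of `H¹` of the simple Kuga–Satake factor `B₈`, of `ℚ`-dimension 16),
`Y₁ := C⁺(T₄)·E`, `Y₂ := C⁻(T₄)·f₁·E`, and `t := 5 + 3·f₁f₂`.

This file realises the Clifford algebra of the diagonal form `D = [1, -1, q₁, q₂, q₃, q₄]` on the
blade basis (`e_A · e_B = ± (∏_{i ∈ A ∩ B} Dᵢ) · e_{A △ B}`, the sign counting the transpositions
needed to sort; blades are bitmasks `A ⊂ {0,…,5}`, bit `0 = f₁`, bit `1 = f₂`, bits `2..5 = e₁..e₄`),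
elements being finitely supported integer combinations of blades, and checks by `decide +kernel`
(exhaustive evaluation inside the kernel; no `native_decide`, no extra axioms), for the three lattices
`T₄ = ⟨1,-2,-6,-21⟩`, `⟨1,-2,-6,-5⟩`, `⟨1,-2,-3,-10⟩` (the transcendental lattices, up to the hyperbolic
plane, of the first "quaternionic" `ρ = 16` curves of the `U² ⊕ D₄(-1)` face, with
`E_T = ℚ(√-7), ℚ(√-15), ℚ(√-15)`), the identities

* `E·E = 2E`;  `f₁f₂·E = E`,  `f₁f₂·(f₁E) = -(f₁E)`  (so `Y₁`, `Y₂` are the `±1`-eigenspaces of `f₁f₂`);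
* `t·t̃ = t̃·t = 16` (`t̃ = 5 - 3f₁f₂` the reversion of `t`) and `t·v·t̃` is again a VECTOR for each of the
  six generators `v` — so `t/4` lies in the spin group of `T` (it is the rational point `(5/4, 3/4)` of
  the split torus `a + b·f₁f₂`, `a² - b² = 1`, of `Spin(U)`);
* `t·E = 8E` and `t·(f₁E) = 2(f₁E)`: `t` acts on `Y₁` by `8` and on `Y₂` by `2`;
* `E·f₁·E = 0 = E·f₂·E` and `E` commutes with every blade of `C(T₄)`; `f₁` commutes with the even and
  anticommutes with the odd blades of `C(T₄)` — so `E·C⁺(T)·E = C⁺(T₄)·E`, and `Y₁`, `Y₂` are stable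
  under right multiplication by `𝔻 := ε C⁺(T) ε ≅ C⁺(T₄)`, the (quaternion, over `E_T = ℚ(z)`)
  endomorphism algebra of `B₈`;
* `z := e₁e₂e₃e₄` satisfies `z² = q₁q₂q₃q₄` (`= -252, -60, -60`) and is central in `C⁺(T₄)`.

Consequence (the two-line argument is `weight_kills` below; recorded on the paper side as
PROPOSITION LW (ii)): every `Spin(T)`-invariant bilinear form `ψ` on `Y` — in particular EVERY polarization
of `B₈`, at every point of the period domain — satisfies `ψ(x,y) = ψ((t/4)x, (t/4)y) = 4ψ(x,y)` on
`Y₁ × Y₁` and `= ψ(x,y)/4` on `Y₂ × Y₂`, hence vanishes there: `Y = Y₁ ⊕ Y₂` is a decomposition into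
`𝔻`-stable LAGRANGIANS.  For every Rosati-stable CM subfield `L ⊂ 𝔻` (biquadratic, `L = E_T(u)`) the
`L`-hermitian form of `(B₈, L, ψ)` therefore has a 2-dimensional isotropic subspace, i.e. `(B₈, L, ψ)` is
of split Weil type in the sense of Deligne–Milne / Markman (arXiv:2509.23079, Def. 8.3.5), and
`(B₈, E_T, ψ)` is a split Weil eightfold.  (Exact linear algebra on the paper side confirms, for the same
three lattices, that the invariant forms make up `4` alternating + `4` symmetric dimensions and kill
`Y₁ × Y₁`, `Y₂ × Y₂`.)
-/

namespace Summit.HodgeConjecture.HodgeConjecture.Theorems.SpinLagrangian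

/-! ## A computable model of the Clifford algebra of a diagonal senary form -/

/-- Elements of the Clifford algebra: finitely supported lists `(blade bitmask, integer coefficient)`. -/
abbrev Cl := List (ℕ × ℤ)

/-- The `i`-th diagonal Gram entry of `D` (`0` out of range). -/
def q (D : List ℤ) (i : ℕ) : ℤ := D.getD i 0

/-- Number of generators occurring in the blade `a` strictly above position `j`. -/
def above (a j : ℕ) : ℕ := ((List.range 6).filter (fun i => decide (j < i) && a.testBit i)).length

/-- Reordering sign of the blade product `e_a · e_b`. -/
def sgn (a b : ℕ) : ℤ :=
  if ((((List.range 6).filter (fun j => b.testBit j)).map (above a)).sum) % 2 = 0 then 1 else -1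

/-- Product of the Gram entries over the common generators of the blades `a` and `b`. -/
def wt (D : List ℤ) (a b : ℕ) : ℤ :=
  ((List.range 6).filter (fun i => a.testBit i && b.testBit i)).foldl (fun acc i => acc * q D i) 1

/-- Coefficient of the blade `m` in `x`. -/
def coeff (x : Cl) (m : ℕ) : ℤ := (x.filter (fun p => p.1 == m)).foldl (fun s p => s + p.2) 0

/-- Normal form: one entry per blade in increasing order, zero coefficients dropped. -/
def nf (x : Cl) : Cl :=
  (List.range 64).filterMap (fun m => if coeff x m == 0 then none else some (m, coeff x m))

/-- Clifford product (normalised). -/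
def mul (D : List ℤ) (x y : Cl) : Cl :=
  nf (x.flatMap (fun p => y.map (fun r => (p.1 ^^^ r.1, sgn p.1 r.1 * wt D p.1 r.1 * p.2 * r.2))))

/-- Integer multiple (normalised). -/
def smul (c : ℤ) (x : Cl) : Cl := nf (x.map (fun p => (p.1, c * p.2)))

/-- The blade with bitmask `m`. -/
def bl (m : ℕ) : Cl := [(m, 1)]

/-- Number of generators in the blade `m` (its degree). -/
def deg (m : ℕ) : ℕ := ((List.range 6).filter (fun i => m.testBit i)).length

/-- `x` is a vector: supported on blades of degree one. -/
def isVector (x : Cl) : Bool := x.all (fun p => deg p.1 == 1)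

/-! ## The named elements -/

/-- `f₁` (bit 0, square `1`). -/
def f1 : Cl := bl 1
/-- `f₂` (bit 1, square `-1`). -/
def f2 : Cl := bl 2
/-- `f₁f₂`. -/
def f12 : Cl := bl 3
/-- The unit `1`. -/
def one : Cl := bl 0
/-- `E = 1 + f₁f₂ = 2ε`. -/
def E : Cl := [(0, 1), (3, 1)]
/-- `t = 5 + 3 f₁f₂`, four times a rational point of the split torus of `Spin(U)`. -/
def t : Cl := [(0, 5), (3, 3)]
/-- The reversion `t̃ = 5 - 3 f₁f₂` of `t`. -/
def trev : Cl := [(0, 5), (3, -3)]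
/-- `z = e₁e₂e₃e₄` (bits 2..5), a generator of the centre `E_T` of `C⁺(T₄)`. -/
def z : Cl := bl 60
/-- The six generators `f₁, f₂, e₁, …, e₄`. -/
def gens : List Cl := (List.range 6).map (fun i => bl (2 ^ i))
/-- The sixteen blades of `C(T₄)` (bitmasks using bits 2..5 only). -/
def t4blades : List ℕ := (List.range 16).map (fun k => 4 * k)

/-! ## The certificate -/

/-- All identities of the module docstring, for the Gram diagonal `D = [1, -1, q₁, q₂, q₃, q₄]`. -/
def cert (D : List ℤ) : Bool :=
  -- idempotent and the two eigenspaces of f₁f₂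
  (mul D E E == smul 2 E) && (mul D f12 E == E) && (mul D f12 (mul D f1 E) == smul (-1) (mul D f1 E)) &&
  -- t/4 ∈ Spin(T): norm 16 and conjugation preserves the vectors
  (mul D t trev == smul 16 one) && (mul D trev t == smul 16 one) &&
  gens.all (fun v => isVector (mul D (mul D t v) trev)) &&
  -- weights of t on Y₁ = C⁺(T₄)E and Y₂ = C⁻(T₄)f₁E
  (mul D t E == smul 8 E) && (mul D t (mul D f1 E) == smul 2 (mul D f1 E)) &&
  -- E C⁺(T) E = C⁺(T₄) E : odd U-parts are killed, E commutes with C(T₄)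
  (mul D (mul D E f1) E == []) && (mul D (mul D E f2) E == []) &&
  t4blades.all (fun m => mul D E (bl m) == mul D (bl m) E) &&
  -- f₁ commutes with even, anticommutes with odd blades of C(T₄)
  t4blades.all (fun m => mul D f1 (bl m) ==
    (if deg m % 2 == 0 then mul D (bl m) f1 else smul (-1) (mul D (bl m) f1))) &&
  -- the centre: z² = q₁q₂q₃q₄ and z commutes with C⁺(T₄) and with f₁f₂
  (mul D z z == smul (q D 2 * q D 3 * q D 4 * q D 5) one) &&
  t4blades.all (fun m => !(deg m % 2 == 0) || (mul D z (bl m) == mul D (bl m) z)) &&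
  (mul D z f12 == mul D f12 z)

set_option maxHeartbeats 4000000 in
/-- The curve `(a,b) = (1,7)`: `T₄ = ⟨1,-2,-6,-21⟩`, `E_T = ℚ(√-7)`. -/
theorem cert_1_7 : cert [1, -1, 1, -2, -6, -21] = true := by decide +kernel

set_option maxHeartbeats 4000000 in
/-- The curve `(a,b) = (3,5)`: `T₄ = ⟨1,-2,-6,-5⟩`, `E_T = ℚ(√-15)`. -/
theorem cert_3_5 : cert [1, -1, 1, -2, -6, -5] = true := by decide +kernel

set_option maxHeartbeats 4000000 in
/-- The curve `(a,b) = (1,15)`: `T₄ = ⟨1,-2,-3,-10⟩`, `E_T = ℚ(√-15)`. -/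
theorem cert_1_15 : cert [1, -1, 1, -2, -3, -10] = true := by decide +kernel

set_option maxHeartbeats 4000000 in
/-- The squares of the centre generator: `z² = -252, -60, -60` (so `E_T = ℚ(z) = ℚ(√-7), ℚ(√-15), ℚ(√-15)`). -/
theorem z_sq :
    mul [1, -1, 1, -2, -6, -21] z z = [(0, -252)] ∧ mul [1, -1, 1, -2, -6, -5] z z = [(0, -60)] ∧
    mul [1, -1, 1, -2, -3, -10] z z = [(0, -60)] := by decide +kernel

/-! ## The two-line consequence: a torus weight different from `±1` kills an invariant pairing -/

/-- If a pairing value `c = ψ(x,y)` is invariant under an element acting on both arguments by the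
scalar `w` with `w² ≠ 1` (here `w = 2 = 8/4` on `Y₁` and `w = 1/2 = 2/4` on `Y₂`), then `c = 0`:
the weight spaces `Y₁`, `Y₂` are isotropic for every `Spin(T)`-invariant bilinear form. -/
theorem weight_kills {K : Type*} [Field K] (w c : K) (hw : w ^ 2 ≠ 1) (h : w * w * c = c) : c = 0 := by
  have h1 : (w ^ 2 - 1) * c = 0 := by ring_nf; linear_combination h
  rcases mul_eq_zero.mp h1 with h2 | h2
  · exact absurd (sub_eq_zero.mp h2) hw
  · exact h2

/-- The instance used: weights `2` on `Y₁` and `2⁻¹` on `Y₂` over `ℚ`. -/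
theorem weights_ne : (2 : ℚ) ^ 2 ≠ 1 ∧ ((2 : ℚ)⁻¹) ^ 2 ≠ 1 := by norm_num

end Summit.HodgeConjecture.HodgeConjecture.Theorems.SpinLagrangian
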